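import Summits.Ventures.LatticeQCDFlow.Scaling.HubProposalLaw

/-!
HONEST FRAMING: exact (Metropolis-corrected) sampling algorithms for lattice gauge theory; figures
of merit are autocorrelation/cost numbers at stated couplings and volumes; no continuum-physics
claim.

# FlowHubProposalLaw — MAPS ON THE HUB EDGES DO NOT CHANGE THE PROPOSAL LAW: A HUB LIST `r ↦ (0, κ_r+1)` WITH THE
# LEVEL MAP `φ_{κ_r}` ON EACH ENTRY IS CONJUGATE TO THE SAME LIST WITH IDENTITY MAPS FOR THE PULLED-BACK LAWS, SO
# UNDER TRANSPORTED DOMINATION `p·μ_{k+1}(φ_k u) ≤ μ_0(u)` THE RAREST HUB EDGE IS STILL THE RATE: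
# `p·min{t·c/(6m), γ₀(1−t)/(14K)} ≤ Gap ≤ t·c_k/(2m·v)`, AND NO PROPOSAL LAW BEATS `t/(2Kv)` (lean-2 GEN-23, ours)

Venture-side (OURS).  Cell `lqcd-flow` (pub-lqcd), unit `pub-lqcd-lean-2-g23`, 2026-08-26.  Chapter K, file 4: the map
version of `Scaling/HubProposalLaw` (K2) by the level-coordinate conjugacy of `Scaling/FlowHubSchemeFloor` (I2),
extended from the star list `k ↦ (0, k+1)` to an arbitrary HUB LIST `κ : Fin m → Fin K` (entry `r` is the hub edge
`(0, κ_r+1)`, possibly repeated — a proposal law over the hub edges) carrying the LEVEL map `φ_{κ_r}` of its cold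
endpoint (one learned bijection per cold level, used by every entry at that level).  `c_k = #{r : κ_r = k}` is the
multiplicity of the edge `(0, k+1)`.

## What is proved

* §1 `hubList_filter_eq` (the multiplicity of `(0, k+1)` in the hub list is `#{r : κ_r = k}`);
  **`ptGraphProposal_hubListRelabel`**, **`flowHubList_apply_eq_conj`**, **`flowHubList_spectralGap_eq`** — the
  map-assisted hub-list scheme `P^φ = t·ptGraphSwap μ e φ + (1−t)·prodKernel w M` IS the identity-map scheme for the
  pulled-back laws `ν_0 = μ_0`, `ν_{k+1} = μ_{k+1}∘φ_k` and the conjugated cold updates, read through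
  `Ψ(x)_{k+1} = φ_k⁻¹(x_{k+1})`; the spectral gaps are equal.
* §2 **`flowHubList_spectralGap_ge`** — transported domination `p·μ_{k+1}(φ_k u) ≤ μ_0(u)`, hot Poincaré constant
  `γ₀`, weights with `w_0 > 0`, every hub edge listed `≥ c ≥ 1` times: `Gap(P^φ) ≥ p·min{t·c/(6m), γ₀(1−t)w_0/(14K)}`.
* §3 **`flowHubList_spectralGap_two_sided`** — hot-only updates, a set `A` whose TRANSPORTED masses satisfy
  `μ_{k+1}(φ_k A)·μ_{k+1}(φ_k Aᶜ) ≥ v > 0`: `p·min{t·c/(6m), γ₀(1−t)/(14K)} ≤ Gap(P^φ) ≤ t·c_k/(2m·v)` for every cold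
  level; **`flowHubList_spectralGap_le_uniformLaw`** — for EVERY hub list, EVERY level maps and EVERY update allocation
  (cold replicas idle): `Gap(P^φ) ≤ t/(2K·v)`.

Reading (no numerics implied): learned transports between the hot law and each cold law change WHICH configurations are
exchanged, never HOW OFTEN a cold replica is offered one; the proposal frequencies keep their linear price with or
without maps, and perfect transports (`μ_{k+1}∘φ_k = μ_0`, `p = 1`) leave exactly the proposal law and the tunnelling
rate in the constants.  NOT CLAIMED: maps that differ between entries at the same cold level (no single change of
coordinates); cold replicas that relax within sectors; continuous spaces; anything measured.  Literature grade (cell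
rule): OWN MECHANISM (I2's conjugacy on hub lists), NEW TYPING; nothing cited as a fact; no new bib keys.
-/

noncomputable section

open Finset Function
open Literature.Probability.MarkovChains

namespace Summit.Ventures.LatticeQCDFlow.Scaling

variable {S : Type*} [Fintype S] [DecidableEq S] {K m : ℕ} {μ : Fin (K + 1) → S → ℝ}
  {M : Fin (K + 1) → S → S → ℝ} {w : Fin (K + 1) → ℝ} {t : ℝ}

section HubList
variable (κ : Fin m → Fin K) (φ : Fin K → Equiv.Perm S)

/-! ## §1 Hub lists and the level-coordinate conjugacy -/

omit [Fintype S] [DecidableEq S] in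
/-- The multiplicity of the hub edge `(0, k+1)` in the hub list is `#{r : κ_r = k}`. [ours] -/
theorem hubList_filter_eq (k : Fin K) :
    univ.filter (fun r : Fin m => (fun r : Fin m => ((0 : Fin (K + 1)), (κ r).succ)) r = ((0 : Fin (K + 1)), k.succ))
      = univ.filter (fun r : Fin m => κ r = k) := by
  refine Finset.filter_congr fun r _ => ?_
  simp only [Prod.mk.injEq, true_and, Fin.succ_inj]

omit [Fintype S] in
/-- **The hub-list proposal with level maps relabels onto the hub-list proposal with identity maps.** [ours] -/
theorem ptGraphProposal_hubListRelabel (x y : Fin (K + 1) → S) :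
    ptGraphProposal (fun r : Fin m => ((0 : Fin (K + 1)), (κ r).succ)) (fun r => φ (κ r)) x y
      = ptGraphProposal (fun r : Fin m => ((0 : Fin (K + 1)), (κ r).succ)) (fun _ : Fin m => Equiv.refl S)
          (fun i => (Fin.cons (Equiv.refl S) (fun k => (φ k).symm) : Fin (K + 1) → Equiv.Perm S) i (x i))
          (fun i => (Fin.cons (Equiv.refl S) (fun k => (φ k).symm) : Fin (K + 1) → Equiv.Perm S) i (y i)) := by
  unfold ptGraphProposal
  refine sum_congr rfl fun r _ => ?_
  have hΨinj : Function.Injective (fun (z : Fin (K + 1) → S) (i : Fin (K + 1)) =>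
      (Fin.cons (Equiv.refl S) (fun k => (φ k).symm) : Fin (K + 1) → Equiv.Perm S) i (z i)) := by
    intro z z' h; funext i
    exact ((Fin.cons (Equiv.refl S) (fun k => (φ k).symm) : Fin (K + 1) → Equiv.Perm S) i).injective (congrFun h i)
  refine if_congr ?_ rfl rfl
  simp only
  rw [edgeFlowSwap_one (Fin.succ_ne_zero (κ r)).symm, ← starRelabel_edgeFlowSwap φ x (κ r)]
  exact ⟨fun h => by rw [h], fun h => hΨinj h⟩

/-- **THE CONJUGATION ON A HUB LIST:** `P^φ(x,y) = P^1_ν(Ψx, Ψy)`. [ours] -/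
theorem flowHubList_apply_eq_conj (hμ : ∀ k x, 0 < μ k x) (t : ℝ) (w : Fin (K + 1) → ℝ) (x y : Fin (K + 1) → S) :
    t * ptGraphSwap μ (fun r : Fin m => ((0 : Fin (K + 1)), (κ r).succ)) (fun r => φ (κ r)) x y
        + (1 - t) * prodKernel w M x y
      = t * ptGraphSwap (fun i u => μ i (((Fin.cons (Equiv.refl S) (fun k => (φ k).symm) :
              Fin (K + 1) → Equiv.Perm S) i).symm u))
            (fun r : Fin m => ((0 : Fin (K + 1)), (κ r).succ)) (fun _ : Fin m => Equiv.refl S)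
            (fun i => (Fin.cons (Equiv.refl S) (fun k => (φ k).symm) : Fin (K + 1) → Equiv.Perm S) i (x i))
            (fun i => (Fin.cons (Equiv.refl S) (fun k => (φ k).symm) : Fin (K + 1) → Equiv.Perm S) i (y i))
        + (1 - t) * prodKernel w (fun i u v => M i
              (((Fin.cons (Equiv.refl S) (fun k => (φ k).symm) : Fin (K + 1) → Equiv.Perm S) i).symm u)
              (((Fin.cons (Equiv.refl S) (fun k => (φ k).symm) : Fin (K + 1) → Equiv.Perm S) i).symm v))
            (fun i => (Fin.cons (Equiv.refl S) (fun k => (φ k).symm) : Fin (K + 1) → Equiv.Perm S) i (x i))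
            (fun i => (Fin.cons (Equiv.refl S) (fun k => (φ k).symm) : Fin (K + 1) → Equiv.Perm S) i (y i)) := by
  have _ := hμ
  congr 2
  · unfold ptGraphSwap
    have h := mhKernel_conj (Equiv.piCongrRight (Fin.cons (Equiv.refl S) (fun k => (φ k).symm) :
        Fin (K + 1) → Equiv.Perm S))
      (T := ptGraphProposal (fun r : Fin m => ((0 : Fin (K + 1)), (κ r).succ)) (fun r => φ (κ r))) (π := tensorFun μ)
      (fun a b => by rw [starRelabel_apply, starRelabel_apply]; exact ptGraphProposal_hubListRelabel κ φ a b)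
      (fun a => by rw [starRelabel_apply]; exact tensorFun_starRelabel φ μ a) x y
    rw [starRelabel_apply, starRelabel_apply] at h
    exact h
  · exact prodKernel_conj _ w M x y

/-- **THE SPECTRAL GAP OF THE MAP-ASSISTED HUB LIST IS THAT OF THE CONJUGATE IDENTITY-MAP LIST.** [ours] -/
theorem flowHubList_spectralGap_eq (hμ : ∀ k x, 0 < μ k x) (t : ℝ) (w : Fin (K + 1) → ℝ) :
    spectralGap (tensorFun μ) (fun x y : Fin (K + 1) → S =>
        t * ptGraphSwap μ (fun r : Fin m => ((0 : Fin (K + 1)), (κ r).succ)) (fun r => φ (κ r)) x y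
          + (1 - t) * prodKernel w M x y)
      = spectralGap (tensorFun (fun i u => μ i (((Fin.cons (Equiv.refl S) (fun k => (φ k).symm) :
            Fin (K + 1) → Equiv.Perm S) i).symm u)))
          (fun x y : Fin (K + 1) → S =>
            t * ptGraphSwap (fun i u => μ i (((Fin.cons (Equiv.refl S) (fun k => (φ k).symm) :
                  Fin (K + 1) → Equiv.Perm S) i).symm u))
                (fun r : Fin m => ((0 : Fin (K + 1)), (κ r).succ)) (fun _ : Fin m => Equiv.refl S) x y
              + (1 - t) * prodKernel w (fun i u v => M i
                  (((Fin.cons (Equiv.refl S) (fun k => (φ k).symm) : Fin (K + 1) → Equiv.Perm S) i).symm u)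
                  (((Fin.cons (Equiv.refl S) (fun k => (φ k).symm) : Fin (K + 1) → Equiv.Perm S) i).symm v)) x y) := by
  refine Eq.trans ?_ (spectralGap_conj (Equiv.piCongrRight (Fin.cons (Equiv.refl S) (fun k => (φ k).symm) :
    Fin (K + 1) → Equiv.Perm S)) _ _)
  congr 1
  · funext x; rw [starRelabel_apply]; exact tensorFun_starRelabel φ μ x
  · funext x y; rw [starRelabel_apply, starRelabel_apply]; exact flowHubList_apply_eq_conj κ φ hμ t w x y

/-! ## §2 The floor with multiplicity under transported domination -/

/-- **THE MAP-ASSISTED HUB-LIST FLOOR:** transported domination `p·μ_{k+1}(φ_k u) ≤ μ_0(u)` (`0 < p ≤ 1`), hot Poincaré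
constant `γ₀`, weights `w` with `w_0 > 0`, every hub edge listed `≥ c ≥ 1` times, cold updates arbitrary
`μ_k`-reversible (`K, m ≥ 1`, `0 < t < 1`, `|S| ≥ 2`): **`Gap(P^φ) ≥ p·min{t·c/(6m), γ₀(1−t)w_0/(14K)}`**. [ours] -/
theorem flowHubList_spectralGap_ge [Nontrivial S] (hK : 1 ≤ K) (hm : 1 ≤ m) {c : ℕ}
    (hc : ∀ k : Fin K, c ≤ (univ.filter (fun r : Fin m => κ r = k)).card) (hc1 : 1 ≤ c) (hμ : ∀ k x, 0 < μ k x)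
    (hμ1 : ∀ k, ∑ u, μ k u = 1) (hM : ∀ k, IsRowStochastic (M k)) (hMrev : ∀ k, DetailedBalance (μ k) (M k))
    (hw0 : ∀ k, 0 ≤ w k) (hw1 : ∑ k, w k = 1) (hwhot : 0 < w 0) (ht0 : 0 < t) (ht1 : t < 1) {p γ₀ : ℝ}
    (hp : 0 < p) (hp1 : p ≤ 1) (hγ₀ : 0 < γ₀) (hdom : ∀ (k : Fin K) (u : S), p * μ k.succ (φ k u) ≤ μ 0 u)
    (hgap0 : ∀ h : S → ℝ, γ₀ * lawVariance (μ 0) h ≤ dirichletForm (μ 0) (M 0) h) :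
    p * min (t * c / (6 * m)) (γ₀ * (1 - t) * w 0 / (14 * K))
      ≤ spectralGap (tensorFun μ) (fun x y : Fin (K + 1) → S =>
          t * ptGraphSwap μ (fun r : Fin m => ((0 : Fin (K + 1)), (κ r).succ)) (fun r => φ (κ r)) x y
            + (1 - t) * prodKernel w M x y) := by
  rw [flowHubList_spectralGap_eq κ φ hμ t w]
  set L : Fin (K + 1) → Equiv.Perm S := Fin.cons (Equiv.refl S) (fun k => (φ k).symm) with hL
  have hL0 : ∀ u, (L 0).symm u = u := fun u => by rw [hL, starLevel_zero]; rfl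
  have hLs : ∀ (k : Fin K) (u : S), (L k.succ).symm u = φ k u := fun k u => by
    rw [hL, starLevel_succ, Equiv.symm_symm]
  have hν0 : (fun u => μ 0 ((L 0).symm u)) = μ 0 := funext fun u => by rw [hL0]
  have hM0 : (fun u v => M 0 ((L 0).symm u) ((L 0).symm v)) = M 0 := funext fun u => funext fun v => by rw [hL0, hL0]
  have hc' : ∀ k : Fin K, c ≤ (univ.filter (fun r : Fin m =>
      (fun r : Fin m => ((0 : Fin (K + 1)), (κ r).succ)) r = ((0 : Fin (K + 1)), k.succ))).card := fun k => by
    rw [hubList_filter_eq κ k]; exact hc k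
  refine multiHub_spectralGap_ge (μ := fun i u => μ i ((L i).symm u))
    (M := fun i u v => M i ((L i).symm u) ((L i).symm v)) (e := fun r : Fin m => ((0 : Fin (K + 1)), (κ r).succ))
    hK hm (fun r => (Fin.succ_ne_zero (κ r)).symm) hc' hc1 (fun k u => hμ k _)
    (fun k => by rw [Equiv.sum_comp (L k).symm (μ k)]; exact hμ1 k) (fun k => ⟨fun u v => (hM k).1 _ _, fun u => ?_⟩)
    (fun k u v => hMrev k _ _) hw0 hw1 hwhot ht0 ht1 hp hp1 hγ₀ (fun k u => ?_) ?_
  · simpa using (Equiv.sum_comp (L k).symm (fun v => M k ((L k).symm u) v)).trans ((hM k).2 _)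
  · simp only [hL0, hLs]; exact hdom k u
  · intro h
    have e1 : lawVariance (fun u => μ 0 ((L 0).symm u)) h = lawVariance (μ 0) h := by rw [hν0]
    have e2 : dirichletForm (fun u => μ 0 ((L 0).symm u)) (fun u v => M 0 ((L 0).symm u) ((L 0).symm v)) h
        = dirichletForm (μ 0) (M 0) h := by rw [hν0, hM0]
    rw [e1, e2]; exact hgap0 h

/-! ## §3 The proposal law with maps: two-sided, and the uniform ceiling -/

/-- **THE PROPOSAL LAW WITH MAPS, TWO-SIDED:** hub list with level maps, hot-only updates (`w = 𝟙_{k=0}`), transported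
domination, hot Poincaré constant `γ₀`, every hub edge listed `≥ c ≥ 1` times, and a set `A` with transported masses
`μ_{k+1}(φ_k A)·μ_{k+1}(φ_k Aᶜ) ≥ v > 0` at the cold level `k+1` of multiplicity `c_k`:
**`p·min{t·c/(6m), γ₀(1−t)/(14K)} ≤ Gap(P^φ) ≤ t·c_k/(2m·v)`**. [ours] -/
theorem flowHubList_spectralGap_two_sided [Nontrivial S] (hK : 1 ≤ K) (hm : 1 ≤ m) {c : ℕ}
    (hc : ∀ k : Fin K, c ≤ (univ.filter (fun r : Fin m => κ r = k)).card) (hc1 : 1 ≤ c) (hμ : ∀ k x, 0 < μ k x)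
    (hμ1 : ∀ k, ∑ u, μ k u = 1) (hM : ∀ k, IsRowStochastic (M k)) (hMrev : ∀ k, DetailedBalance (μ k) (M k))
    (ht0 : 0 < t) (ht1 : t < 1) {p γ₀ : ℝ} (hp : 0 < p) (hp1 : p ≤ 1) (hγ₀ : 0 < γ₀)
    (hdom : ∀ (k : Fin K) (u : S), p * μ k.succ (φ k u) ≤ μ 0 u)
    (hgap0 : ∀ g : S → ℝ, γ₀ * lawVariance (μ 0) g ≤ dirichletForm (μ 0) (M 0) g) {A : Finset S} {v : ℝ}
    (hvpos : 0 < v) (k : Fin K) (hv : v ≤ (∑ u ∈ A, μ k.succ (φ k u)) * ∑ u ∈ Aᶜ, μ k.succ (φ k u)) :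
    p * min (t * c / (6 * m)) (γ₀ * (1 - t) / (14 * K))
        ≤ spectralGap (tensorFun μ) (fun x y : Fin (K + 1) → S =>
            t * ptGraphSwap μ (fun r : Fin m => ((0 : Fin (K + 1)), (κ r).succ)) (fun r => φ (κ r)) x y
              + (1 - t) * prodKernel (fun i : Fin (K + 1) => if i = 0 then (1 : ℝ) else 0) M x y)
      ∧ spectralGap (tensorFun μ) (fun x y : Fin (K + 1) → S =>
            t * ptGraphSwap μ (fun r : Fin m => ((0 : Fin (K + 1)), (κ r).succ)) (fun r => φ (κ r)) x y
              + (1 - t) * prodKernel (fun i : Fin (K + 1) => if i = 0 then (1 : ℝ) else 0) M x y)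
          ≤ t * ((univ.filter (fun r : Fin m => κ r = k)).card : ℝ) / (2 * m * v) := by
  have hw0 : ∀ i : Fin (K + 1), 0 ≤ (if i = 0 then (1 : ℝ) else 0) := fun i => by positivity
  refine ⟨?_, ?_⟩
  · have h := flowHubList_spectralGap_ge κ φ (M := M) (w := fun i : Fin (K + 1) => if i = 0 then (1 : ℝ) else 0) hK
      hm hc hc1 hμ hμ1 hM hMrev hw0 hotOnlyWeight_sum (by simp) ht0 ht1 hp hp1 hγ₀ hdom hgap0
    simpa using h
  · rw [flowHubList_spectralGap_eq κ φ hμ t]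
    set L : Fin (K + 1) → Equiv.Perm S := Fin.cons (Equiv.refl S) (fun k => (φ k).symm) with hL
    have hLs : ∀ (k : Fin K) (u : S), (L k.succ).symm u = φ k u := fun k u => by
      rw [hL, starLevel_succ, Equiv.symm_symm]
    have hc' : ∀ k : Fin K, c ≤ (univ.filter (fun r : Fin m =>
        (fun r : Fin m => ((0 : Fin (K + 1)), (κ r).succ)) r = ((0 : Fin (K + 1)), k.succ))).card := fun k => by
      rw [hubList_filter_eq κ k]; exact hc k
    have hv' : v ≤ (∑ u ∈ A, μ k.succ ((L k.succ).symm u)) * ∑ u ∈ Aᶜ, μ k.succ ((L k.succ).symm u) := by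
      simp only [hLs]; exact hv
    have h := (multistar_spectralGap_two_sided (μ := fun i u => μ i ((L i).symm u))
      (M := fun i u v => M i ((L i).symm u) ((L i).symm v)) (e := fun r : Fin m => ((0 : Fin (K + 1)), (κ r).succ))
      hK hm (fun _ => rfl) (fun r => (Fin.succ_ne_zero (κ r)).symm) hc' hc1 (fun k u => hμ k _)
      (fun k => by rw [Equiv.sum_comp (L k).symm (μ k)]; exact hμ1 k)
      (fun k => ⟨fun u v => (hM k).1 _ _, fun u => by
        simpa using (Equiv.sum_comp (L k).symm (fun v => M k ((L k).symm u) v)).trans ((hM k).2 _)⟩)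
      (fun k u v => hMrev k _ _) ht0 ht1 hp hp1 hγ₀ (fun k u => by
        simp only [hL, starLevel_zero, starLevel_succ, Equiv.symm_symm]; exact hdom k u)
      (fun g => by
        have hL0 : ∀ u, (L 0).symm u = u := fun u => by rw [hL, starLevel_zero]; rfl
        have hν0 : (fun u => μ 0 ((L 0).symm u)) = μ 0 := funext fun u => by rw [hL0]
        have hM0 : (fun u v => M 0 ((L 0).symm u) ((L 0).symm v)) = M 0 :=
          funext fun u => funext fun v => by rw [hL0, hL0]
        have e1 : lawVariance (fun u => μ 0 ((L 0).symm u)) g = lawVariance (μ 0) g := by rw [hν0]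
        have e2 : dirichletForm (fun u => μ 0 ((L 0).symm u)) (fun u v => M 0 ((L 0).symm u) ((L 0).symm v)) g
            = dirichletForm (μ 0) (M 0) g := by rw [hν0, hM0]
        rw [e1, e2]; exact hgap0 g)
      hvpos k hv').2
    rw [hubList_filter_eq κ k] at h
    exact h

/-- **NO PROPOSAL LAW BEATS `t/(2Kv)`, WITH OR WITHOUT MAPS:** every hub list, every level maps, every update allocation
with idle cold replicas (`w_{k+1}·Q_{k+1} = 0` for the pulled-back cold updates — in particular hot-only updates, or
cold updates frozen on the transported sector), and a set `A` with `μ_{k+1}(φ_k A)·μ_{k+1}(φ_k Aᶜ) ≥ v > 0` at every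
cold level: **`Gap(P^φ) ≤ t/(2K·v)`**. [ours] -/
theorem flowHubList_spectralGap_le_uniformLaw [Nontrivial S] (hK : 1 ≤ K) (hm : 1 ≤ m) (hμ : ∀ k x, 0 < μ k x)
    (hμ1 : ∀ k, ∑ u, μ k u = 1) (hM : ∀ k, IsRowStochastic (M k)) (hMrev : ∀ k, DetailedBalance (μ k) (M k))
    (hw0 : ∀ k, 0 ≤ w k) (hw1 : ∑ k, w k = 1) (ht0 : 0 ≤ t) (ht1 : t ≤ 1) {A : Finset S} {v : ℝ} (hvpos : 0 < v)
    (hv : ∀ k : Fin K, v ≤ (∑ u ∈ A, μ k.succ (φ k u)) * ∑ u ∈ Aᶜ, μ k.succ (φ k u))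
    (hidle : ∀ k : Fin K, w k.succ * edgeMeasure (fun u => μ k.succ (φ k u)) (fun u v => M k.succ (φ k u) (φ k v))
      A Aᶜ = 0) :
    spectralGap (tensorFun μ) (fun x y : Fin (K + 1) → S =>
        t * ptGraphSwap μ (fun r : Fin m => ((0 : Fin (K + 1)), (κ r).succ)) (fun r => φ (κ r)) x y
          + (1 - t) * prodKernel w M x y)
      ≤ t / (2 * K * v) := by
  rw [flowHubList_spectralGap_eq κ φ hμ t w]
  set L : Fin (K + 1) → Equiv.Perm S := Fin.cons (Equiv.refl S) (fun k => (φ k).symm) with hL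
  have hLs : ∀ (k : Fin K) (u : S), (L k.succ).symm u = φ k u := fun k u => by
    rw [hL, starLevel_succ, Equiv.symm_symm]
  refine multistar_spectralGap_le_uniformLaw (μ := fun i u => μ i ((L i).symm u))
    (M := fun i u v => M i ((L i).symm u) ((L i).symm v)) (e := fun r : Fin m => ((0 : Fin (K + 1)), (κ r).succ))
    (φ := fun _ : Fin m => Equiv.refl S) (A := A) hK hm (fun _ => rfl) (fun r => (Fin.succ_ne_zero (κ r)).symm)
    (fun k u => hμ k _) (fun k => by rw [Equiv.sum_comp (L k).symm (μ k)]; exact hμ1 k)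
    (fun k => ⟨fun u v => (hM k).1 _ _, fun u => by
      simpa using (Equiv.sum_comp (L k).symm (fun v => M k ((L k).symm u) v)).trans ((hM k).2 _)⟩)
    (fun k u v => hMrev k _ _) hw0 hw1 ht0 ht1 (fun _ _ => Iff.rfl) hvpos (fun k hk => ?_) (fun k hk => ?_)
  · obtain ⟨j, rfl⟩ := Fin.exists_succ_eq.mpr hk
    simp only [hLs]; exact hv j
  · obtain ⟨j, rfl⟩ := Fin.exists_succ_eq.mpr hk
    simp only [hLs]; exact hidle j

end HubList

end Summit.Ventures.LatticeQCDFlow.Scaling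

end
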